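import Summits.CriticalPhenomena.PercolationContinuityZ3.Theorems.PercNearOneGluingNoHeavyConstsTwoCopyDownwardFKGCorollaries
import Summits.CriticalPhenomena.PercolationContinuityZ3.Theorems.PercNearOneGluingNoHeavyConstsHardCoreClusterStructure
import HarnessLib

/-!
# HARD-CORE HARRIS / TWO-COPY BHK AT MEASURE LEVEL — every hard-core set `N`, every repelled set `T`
# (`NoHeavyLowerTail`, stmt-CriticalPhenomena-4575; the lead's `Consts.twoCopyBHK_measure` target, LEAD-GEN105 NEXT SEAT (3))

Support file (prover prim-facecert gen 14; `--supports stmt-CriticalPhenomena-4575`); builds on the lead seat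
prim-nh-lead-4575's gen-105 programme (memo `run/shared/lean/prim/prim-nh-lead-4575/LEAD-GEN105.md` §1(6): conjecture (HC)
"hard-core Harris", its reduction to PA-BERN = `Consts.FibrewiseBHK`, and the pencil proof of the MEASURE-LEVEL two-copy
statement by an averaging-operator iteration; `|N| = 1` in the kernel: `…ConstsHardCoreHarrisOne`).  No definitions, no named
facts, no sorries; standard axioms.

SETTING.  Bond percolation with arbitrary edge probabilities `w` on a finite vertex type; two INDEPENDENT copies `ω, ω'`
(double finite sums against `w(ω)·w(ω')`, `w(ω) = BHK2006.weight`); both copies restricted to `D = {S ↮ T}`; the TWO-COPY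
HARD-CORE indicator `1_{HC}(ω,ω') = 1{no v ∈ N is joined to S in both copies}` (`V(C_S(ω)) ∩ V(C_S(ω')) ∩ N = ∅`); monotone
functions `F, G` of the union cluster `C_S = ⋃_{s ∈ S} C_s` (edge sets ordered by inclusion).  Write `Z = 1_D(ω)1_D(ω')1_{HC}(ω,ω')`
and `E` for the double sum against `w(ω)w(ω')`.

THEOREMS (this file; all `N`, `T`, `S`, all weights — the `|N| = 1`, `T = ∅` cases are `Consts.hardCoreHarris_measure_one`,
`Consts.twoCopyAssoc_measure_one`, `Consts.twoCopyNegCorr_measure_one` of `…ConstsHardCoreHarrisOne`):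
* `hardCoreHarris_measure` — (HC) at measure level, "same copy beats cross copy":
  `E[Z·F(C_S(ω))·G(C_S(ω'))] ≤ E[Z·F(C_S(ω))·G(C_S(ω))]`;
* `twoCopyAssoc_measure` — the cluster of copy 0 is POSITIVELY ASSOCIATED under the two-copy hard-core weight:
  `E[Z·F(C_S(ω))]·E[Z·G(C_S(ω))] ≤ E[Z]·E[Z·F(C_S(ω))G(C_S(ω))]` — i.e. BHK's Theorem 1.3 with the RANDOM repelled set
  `T ∪ (V(C_S(ω')) ∩ N)`, the footprint of an independent cluster;
* `twoCopyNegCorr_measure` — a monotone function of `C_S(ω)` and one of `C_S(ω')` are NEGATIVELY correlated under `Z`.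
So at measure level the whole (HC) family is TRUE for every `N`; the FIBREWISE (two-copy-profile) version `Consts.HardCoreBHK`
— equivalent up to kernel bookkeeping to PA-BERN `Consts.FibrewiseBHK` (lead, `…ConstsHardCoreReduction*`) — remains OPEN, and the
fibrewise analogue of `twoCopyNegCorr_measure` is FALSE (lead gen 105, 6 vertices): measure level does not discriminate.

PROOF.  The abstract theorem "the hard-core pair of two downward-FKG laws has associated marginals"
(`TwoCopyHardCore.assoc` / `sameCopy_ge_crossCopy` / `negCorr_symm`) applied to the push-forward weights of `C_S` on `D`, whose
downward-FKG hypothesis is BHK's Theorem 1.3 with sets at the repelled set `T ∪ N(W₂)` (`TwoCopyHardCore.pa_partner`) and whose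
bottom (clusters reaching no vertex of `N`) has weight `w(S ↮ T ∪ N)`; if that weight vanishes every term is zero
(`TwoCopyHardCore.degenerate`).  Exact small-graph check of all three inequalities incl. `T ≠ ∅` (prim-facecert gen 14,
work/py/check_twocopy.py): 0 violations.
[cite: VandenbergHaggstromKahn2005, Thm. 1.3 (p. 6), Thm. 2.1 (p. 9) at q = 1, Remark 1 after Thm. 1.2 (p. 5)]
-/

noncomputable section

namespace Summit.CriticalPhenomena.PercolationContinuityZ3.Theorems

namespace TwoCopyHardCore

open MeasureTheory Set Finset
open Literature.Probability.LatticeModels (prodBernoulli)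
open Literature.Probability.Percolation
open Literature.Probability.Percolation.BHK2006
open DecisionTree (ind ind_of_mem ind_of_not_mem ind_nonneg)
open scoped Classical

variable {V : Type*} [Fintype V]

/-! ### The measure-level two-copy BHK theorems (every hard-core set `N`, every repelled set `T`) -/

section Main

variable (w : Sym2 V → unitInterval) (S T N : Set V)
  {D : Set (BondConfig V)} (hD : ∀ ω, ω ∈ D ↔ ∀ s ∈ S, ∀ t ∈ T, ¬ (openGraph ω).Reachable s t)

include hD in
/-- **Hard-core Harris / two-copy BHK, measure level, EVERY hard-core set `N` and repelled set `T`.**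
Bond percolation with arbitrary edge probabilities `w` on a finite vertex type, two INDEPENDENT copies `ω, ω'`
(double sum against the product weights), both restricted to `D = {S ↮ T}`, the two-copy hard-core indicator
`1_{HC} = 1{no v ∈ N is joined to S in both copies}`, and monotone functions `F, G` of the union cluster
`C_S = ⋃_{s ∈ S} C_s`.  Then "same copy beats cross copy":
`E[1_D 1_D' 1_{HC} · F(C_S(ω)) · G(C_S(ω'))] ≤ E[1_D 1_D' 1_{HC} · F(C_S(ω)) · G(C_S(ω))]`.
For `N = ∅` this is Harris' inequality (times `μ(D)`), for `|N| = 1`, `T = ∅` it is `Consts.hardCoreHarris_measure_one`.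
Proof: `sameCopy_ge_crossCopy` for the push-forward weights of the cluster, whose "downward FKG" hypothesis is BHK's
Theorem 1.3 with sets at `T ∪ N(W₂)` (`pa_partner`); the degenerate case `w(S ↮ T ∪ N) = 0` is `degenerate`.
[this work; cite: VandenbergHaggstromKahn2005, Thm. 1.3 (p. 6) / Thm. 2.1 (p. 9) at q = 1] -/
theorem hardCoreHarris_measure (F G : Set (Sym2 V) → ℝ) (hF : Monotone F) (hG : Monotone G) :
    ∑ ω, ∑ ω', weight (fun e => (w e : ℝ)) ω * weight (fun e => (w e : ℝ)) ω' * (ind D ω * ind D ω' *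
        (if ∀ v ∈ N, ¬ ((∃ s ∈ S, (openGraph ω).Reachable s v) ∧ ∃ s ∈ S, (openGraph ω').Reachable s v)
          then (1 : ℝ) else 0)) *
      (F (⋃ s ∈ S, openEdgeCluster ω s) * G (⋃ s ∈ S, openEdgeCluster ω' s)) ≤
    ∑ ω, ∑ ω', weight (fun e => (w e : ℝ)) ω * weight (fun e => (w e : ℝ)) ω' * (ind D ω * ind D ω' *
        (if ∀ v ∈ N, ¬ ((∃ s ∈ S, (openGraph ω).Reachable s v) ∧ ∃ s ∈ S, (openGraph ω').Reachable s v)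
          then (1 : ℝ) else 0)) *
      (F (⋃ s ∈ S, openEdgeCluster ω s) * G (⋃ s ∈ S, openEdgeCluster ω s)) := by
  by_cases h0 : ∑ ω, weight (fun e => (w e : ℝ)) ω *
      ind {ω : BondConfig V | ∀ s ∈ S, ∀ t ∈ T ∪ N, ¬ (openGraph ω).Reachable s t} ω = 0
  · -- degenerate case: every term vanishes
    have hz := degenerate w S T N D hD h0
    simp only [hz, zero_mul, Finset.sum_const_zero, le_refl]
  -- push-forward data
  set C : BondConfig V → Set (Sym2 V) := fun ω => ⋃ s ∈ S, openEdgeCluster ω s with hCdef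
  have hC : ∀ ω, C ω = ⋃ s ∈ S, openEdgeCluster ω s := fun ω => rfl
  set p : Set (Sym2 V) → ℝ := fun W =>
    ∑ ω, weight (fun e => (w e : ℝ)) ω * ind D ω * (if C ω = W then (1 : ℝ) else 0) with hpdef
  have hp : ∀ W, p W = ∑ ω, weight (fun e => (w e : ℝ)) ω * ind D ω * (if C ω = W then (1 : ℝ) else 0) :=
    fun W => rfl
  set κ : Set (Sym2 V) → Set (Sym2 V) → ℝ := fun W W' =>
    if ∀ v ∈ N, ¬ ((v ∈ S ∨ ∃ e ∈ W, v ∈ e) ∧ (v ∈ S ∨ ∃ e ∈ W', v ∈ e)) then (1 : ℝ) else 0 with hκdef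
  have hκ : ∀ W W', κ W W' =
      if ∀ v ∈ N, ¬ ((v ∈ S ∨ ∃ e ∈ W, v ∈ e) ∧ (v ∈ S ∨ ∃ e ∈ W', v ∈ e)) then (1 : ℝ) else 0 :=
    fun W W' => rfl
  have hw0 : ∀ e, 0 ≤ (w e : ℝ) := fun e => (w e).2.1
  have hw1 : ∀ e, (w e : ℝ) ≤ 1 := fun e => (w e).2.2
  have hp0 : ∀ W, 0 ≤ p W := fun W => Finset.sum_nonneg fun ω _ =>
    mul_nonneg (mul_nonneg (weight_nonneg hw0 hw1 ω) (ind_nonneg _ _)) (by split_ifs <;> norm_num)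
  obtain ⟨hκ01, hκsymm, hκanti⟩ := kernel_props S N κ hκ
  have hPA := pa_partner w S T N D hD C hC p hp κ hκ
  -- the bottom: clusters reaching no vertex of `N`
  set B₀ : Finset (Set (Sym2 V)) :=
    Finset.univ.filter (fun W : Set (Sym2 V) => ∀ v ∈ N, ¬ (v ∈ S ∨ ∃ e ∈ W, v ∈ e)) with hB₀def
  have hB₀ : ∀ W ∈ B₀, ∀ W', κ W W' = 1 := fun W hW W' =>
    bottom_compat S N κ hκ W (Finset.mem_filter.1 hW).2 W'
  have hB₀pos : 0 < ∑ W ∈ B₀, p W := by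
    rw [hB₀def, bottom_mass w S T N D hD C hC p hp]
    exact lt_of_le_of_ne (Finset.sum_nonneg fun ω _ =>
      mul_nonneg (weight_nonneg hw0 hw1 ω) (ind_nonneg _ _)) (Ne.symm h0)
  -- the abstract theorem
  have key := sameCopy_ge_crossCopy p κ hp0 hκ01 hκsymm hκanti hPA B₀ hB₀ hB₀pos F G hF hG
  -- back to configurations
  have hkc : ∀ ω ω', κ (⋃ s ∈ S, openEdgeCluster ω s) (⋃ s ∈ S, openEdgeCluster ω' s) =
      if ∀ v ∈ N, ¬ ((∃ s ∈ S, (openGraph ω).Reachable s v) ∧ ∃ s ∈ S, (openGraph ω').Reachable s v)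
        then (1 : ℝ) else 0 := fun ω ω' => kernel_cluster S N C hC κ hκ ω ω'
  have conv : ∀ Ψ : Set (Sym2 V) → Set (Sym2 V) → ℝ, ∑ W, ∑ W', p W * p W' * κ W W' * Ψ W W' =
      ∑ ω, ∑ ω', weight (fun e => (w e : ℝ)) ω * weight (fun e => (w e : ℝ)) ω' * (ind D ω * ind D ω' *
        (if ∀ v ∈ N, ¬ ((∃ s ∈ S, (openGraph ω).Reachable s v) ∧ ∃ s ∈ S, (openGraph ω').Reachable s v)
          then (1 : ℝ) else 0)) *
        Ψ (⋃ s ∈ S, openEdgeCluster ω s) (⋃ s ∈ S, openEdgeCluster ω' s) := by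
    intro Ψ
    have e1 : ∑ W, ∑ W', p W * p W' * κ W W' * Ψ W W' = ∑ W, ∑ W', p W * p W' * (κ W W' * Ψ W W') :=
      Finset.sum_congr rfl fun W _ => Finset.sum_congr rfl fun W' _ => by ring
    rw [e1, pair_sum_cluster w S D C hC p hp (fun W W' => κ W W' * Ψ W W')]
    exact Finset.sum_congr rfl fun ω _ => Finset.sum_congr rfl fun ω' _ => by
      simp only [hkc ω ω']; ring
  have L := conv (fun W W' => F W * G W')
  have R := conv (fun W W' => F W * G W)
  rw [← L, ← R]
  exact key

include hD in
/-- **Two-copy positive association, measure level, every `N`, `T`** (the lead's `Consts.twoCopyBHK_measure`):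
with the notation of `hardCoreHarris_measure`, the cluster of copy 0 is POSITIVELY ASSOCIATED under the two-copy
hard-core weight: for monotone `F, G`,
`E[Z·F(C_S(ω))] · E[Z·G(C_S(ω))] ≤ E[Z] · E[Z·F(C_S(ω))G(C_S(ω))]`, `Z = 1_D(ω)1_D(ω')1_{HC}(ω,ω')`.
Equivalently: BHK's Theorem 1.3 holds with the RANDOM repelled set `T ∪ (V(C_S(ω')) ∩ N)` given by an independent
cluster.  For `|N| = 1`, `T = ∅` this is `Consts.twoCopyAssoc_measure_one`.  Proof: `assoc_symm` + `pa_partner`.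
[this work] -/
theorem twoCopyAssoc_measure (F G : Set (Sym2 V) → ℝ) (hF : Monotone F) (hG : Monotone G) :
    (∑ ω, ∑ ω', weight (fun e => (w e : ℝ)) ω * weight (fun e => (w e : ℝ)) ω' * (ind D ω * ind D ω' *
        (if ∀ v ∈ N, ¬ ((∃ s ∈ S, (openGraph ω).Reachable s v) ∧ ∃ s ∈ S, (openGraph ω').Reachable s v)
          then (1 : ℝ) else 0)) * F (⋃ s ∈ S, openEdgeCluster ω s)) *
      (∑ ω, ∑ ω', weight (fun e => (w e : ℝ)) ω * weight (fun e => (w e : ℝ)) ω' * (ind D ω * ind D ω' *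
        (if ∀ v ∈ N, ¬ ((∃ s ∈ S, (openGraph ω).Reachable s v) ∧ ∃ s ∈ S, (openGraph ω').Reachable s v)
          then (1 : ℝ) else 0)) * G (⋃ s ∈ S, openEdgeCluster ω s)) ≤
    (∑ ω, ∑ ω', weight (fun e => (w e : ℝ)) ω * weight (fun e => (w e : ℝ)) ω' * (ind D ω * ind D ω' *
        (if ∀ v ∈ N, ¬ ((∃ s ∈ S, (openGraph ω).Reachable s v) ∧ ∃ s ∈ S, (openGraph ω').Reachable s v)
          then (1 : ℝ) else 0))) *
      (∑ ω, ∑ ω', weight (fun e => (w e : ℝ)) ω * weight (fun e => (w e : ℝ)) ω' * (ind D ω * ind D ω' *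
        (if ∀ v ∈ N, ¬ ((∃ s ∈ S, (openGraph ω).Reachable s v) ∧ ∃ s ∈ S, (openGraph ω').Reachable s v)
          then (1 : ℝ) else 0)) * (F (⋃ s ∈ S, openEdgeCluster ω s) * G (⋃ s ∈ S, openEdgeCluster ω s))) := by
  by_cases h0 : ∑ ω, weight (fun e => (w e : ℝ)) ω *
      ind {ω : BondConfig V | ∀ s ∈ S, ∀ t ∈ T ∪ N, ¬ (openGraph ω).Reachable s t} ω = 0
  · have hz := degenerate w S T N D hD h0
    simp only [hz, zero_mul, Finset.sum_const_zero, mul_zero, le_refl]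
  set C : BondConfig V → Set (Sym2 V) := fun ω => ⋃ s ∈ S, openEdgeCluster ω s with hCdef
  have hC : ∀ ω, C ω = ⋃ s ∈ S, openEdgeCluster ω s := fun ω => rfl
  set p : Set (Sym2 V) → ℝ := fun W =>
    ∑ ω, weight (fun e => (w e : ℝ)) ω * ind D ω * (if C ω = W then (1 : ℝ) else 0) with hpdef
  have hp : ∀ W, p W = ∑ ω, weight (fun e => (w e : ℝ)) ω * ind D ω * (if C ω = W then (1 : ℝ) else 0) :=
    fun W => rfl
  set κ : Set (Sym2 V) → Set (Sym2 V) → ℝ := fun W W' =>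
    if ∀ v ∈ N, ¬ ((v ∈ S ∨ ∃ e ∈ W, v ∈ e) ∧ (v ∈ S ∨ ∃ e ∈ W', v ∈ e)) then (1 : ℝ) else 0 with hκdef
  have hκ : ∀ W W', κ W W' =
      if ∀ v ∈ N, ¬ ((v ∈ S ∨ ∃ e ∈ W, v ∈ e) ∧ (v ∈ S ∨ ∃ e ∈ W', v ∈ e)) then (1 : ℝ) else 0 :=
    fun W W' => rfl
  have hw0 : ∀ e, 0 ≤ (w e : ℝ) := fun e => (w e).2.1
  have hw1 : ∀ e, (w e : ℝ) ≤ 1 := fun e => (w e).2.2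
  have hp0 : ∀ W, 0 ≤ p W := fun W => Finset.sum_nonneg fun ω _ =>
    mul_nonneg (mul_nonneg (weight_nonneg hw0 hw1 ω) (ind_nonneg _ _)) (by split_ifs <;> norm_num)
  obtain ⟨hκ01, hκsymm, hκanti⟩ := kernel_props S N κ hκ
  have hPA := pa_partner w S T N D hD C hC p hp κ hκ
  set B₀ : Finset (Set (Sym2 V)) :=
    Finset.univ.filter (fun W : Set (Sym2 V) => ∀ v ∈ N, ¬ (v ∈ S ∨ ∃ e ∈ W, v ∈ e)) with hB₀def
  have hB₀ : ∀ W ∈ B₀, ∀ W', κ W W' = 1 := fun W hW W' =>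
    bottom_compat S N κ hκ W (Finset.mem_filter.1 hW).2 W'
  have hB₀pos : 0 < ∑ W ∈ B₀, p W := by
    rw [hB₀def, bottom_mass w S T N D hD C hC p hp]
    exact lt_of_le_of_ne (Finset.sum_nonneg fun ω _ =>
      mul_nonneg (weight_nonneg hw0 hw1 ω) (ind_nonneg _ _)) (Ne.symm h0)
  have key := assoc_symm p κ hp0 hκ01 hκsymm hκanti hPA B₀ hB₀ hB₀pos F G hF hG
  have hkc : ∀ ω ω', κ (⋃ s ∈ S, openEdgeCluster ω s) (⋃ s ∈ S, openEdgeCluster ω' s) =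
      if ∀ v ∈ N, ¬ ((∃ s ∈ S, (openGraph ω).Reachable s v) ∧ ∃ s ∈ S, (openGraph ω').Reachable s v)
        then (1 : ℝ) else 0 := fun ω ω' => kernel_cluster S N C hC κ hκ ω ω'
  have conv : ∀ Ψ : Set (Sym2 V) → Set (Sym2 V) → ℝ, ∑ W, ∑ W', p W * p W' * κ W W' * Ψ W W' =
      ∑ ω, ∑ ω', weight (fun e => (w e : ℝ)) ω * weight (fun e => (w e : ℝ)) ω' * (ind D ω * ind D ω' *
        (if ∀ v ∈ N, ¬ ((∃ s ∈ S, (openGraph ω).Reachable s v) ∧ ∃ s ∈ S, (openGraph ω').Reachable s v)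
          then (1 : ℝ) else 0)) *
        Ψ (⋃ s ∈ S, openEdgeCluster ω s) (⋃ s ∈ S, openEdgeCluster ω' s) := by
    intro Ψ
    have e1 : ∑ W, ∑ W', p W * p W' * κ W W' * Ψ W W' = ∑ W, ∑ W', p W * p W' * (κ W W' * Ψ W W') :=
      Finset.sum_congr rfl fun W _ => Finset.sum_congr rfl fun W' _ => by ring
    rw [e1, pair_sum_cluster w S D C hC p hp (fun W W' => κ W W' * Ψ W W')]
    exact Finset.sum_congr rfl fun ω _ => Finset.sum_congr rfl fun ω' _ => by
      simp only [hkc ω ω']; ring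
  have conv1 : ∑ W, ∑ W', p W * p W' * κ W W' =
      ∑ ω, ∑ ω', weight (fun e => (w e : ℝ)) ω * weight (fun e => (w e : ℝ)) ω' * (ind D ω * ind D ω' *
        (if ∀ v ∈ N, ¬ ((∃ s ∈ S, (openGraph ω).Reachable s v) ∧ ∃ s ∈ S, (openGraph ω').Reachable s v)
          then (1 : ℝ) else 0)) := by
    have := conv (fun _ _ => 1)
    simp only [mul_one] at this
    exact this
  have eF := conv (fun W _ => F W)
  have eG := conv (fun W _ => G W)
  have eFG := conv (fun W _ => F W * G W)
  rw [← eF, ← eG, ← eFG, ← conv1]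
  exact key

include hD in
/-- **Two-copy negative correlation across the copies, measure level, every `N`, `T`**: with the notation of
`hardCoreHarris_measure`, a monotone function of the cluster of copy 0 and a monotone function of the cluster of
copy 1 are NEGATIVELY correlated under the two-copy hard-core weight:
`E[Z·F(C_S(ω))G(C_S(ω'))] · E[Z] ≤ E[Z·F(C_S(ω))] · E[Z·G(C_S(ω'))]`.  For `|N| = 1`, `T = ∅` this is
`Consts.twoCopyNegCorr_measure_one`; its FIBREWISE analogue is false (lead gen 105, n = 6).  Proof: `negCorr_symm`.
[this work] -/
theorem twoCopyNegCorr_measure (F G : Set (Sym2 V) → ℝ) (hF : Monotone F) (hG : Monotone G) :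
    (∑ ω, ∑ ω', weight (fun e => (w e : ℝ)) ω * weight (fun e => (w e : ℝ)) ω' * (ind D ω * ind D ω' *
        (if ∀ v ∈ N, ¬ ((∃ s ∈ S, (openGraph ω).Reachable s v) ∧ ∃ s ∈ S, (openGraph ω').Reachable s v)
          then (1 : ℝ) else 0)) * (F (⋃ s ∈ S, openEdgeCluster ω s) * G (⋃ s ∈ S, openEdgeCluster ω' s))) *
      (∑ ω, ∑ ω', weight (fun e => (w e : ℝ)) ω * weight (fun e => (w e : ℝ)) ω' * (ind D ω * ind D ω' *
        (if ∀ v ∈ N, ¬ ((∃ s ∈ S, (openGraph ω).Reachable s v) ∧ ∃ s ∈ S, (openGraph ω').Reachable s v)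
          then (1 : ℝ) else 0))) ≤
    (∑ ω, ∑ ω', weight (fun e => (w e : ℝ)) ω * weight (fun e => (w e : ℝ)) ω' * (ind D ω * ind D ω' *
        (if ∀ v ∈ N, ¬ ((∃ s ∈ S, (openGraph ω).Reachable s v) ∧ ∃ s ∈ S, (openGraph ω').Reachable s v)
          then (1 : ℝ) else 0)) * F (⋃ s ∈ S, openEdgeCluster ω s)) *
      (∑ ω, ∑ ω', weight (fun e => (w e : ℝ)) ω * weight (fun e => (w e : ℝ)) ω' * (ind D ω * ind D ω' *
        (if ∀ v ∈ N, ¬ ((∃ s ∈ S, (openGraph ω).Reachable s v) ∧ ∃ s ∈ S, (openGraph ω').Reachable s v)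
          then (1 : ℝ) else 0)) * G (⋃ s ∈ S, openEdgeCluster ω' s)) := by
  by_cases h0 : ∑ ω, weight (fun e => (w e : ℝ)) ω *
      ind {ω : BondConfig V | ∀ s ∈ S, ∀ t ∈ T ∪ N, ¬ (openGraph ω).Reachable s t} ω = 0
  · have hz := degenerate w S T N D hD h0
    simp only [hz, zero_mul, Finset.sum_const_zero, mul_zero, le_refl]
  set C : BondConfig V → Set (Sym2 V) := fun ω => ⋃ s ∈ S, openEdgeCluster ω s with hCdef
  have hC : ∀ ω, C ω = ⋃ s ∈ S, openEdgeCluster ω s := fun ω => rfl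
  set p : Set (Sym2 V) → ℝ := fun W =>
    ∑ ω, weight (fun e => (w e : ℝ)) ω * ind D ω * (if C ω = W then (1 : ℝ) else 0) with hpdef
  have hp : ∀ W, p W = ∑ ω, weight (fun e => (w e : ℝ)) ω * ind D ω * (if C ω = W then (1 : ℝ) else 0) :=
    fun W => rfl
  set κ : Set (Sym2 V) → Set (Sym2 V) → ℝ := fun W W' =>
    if ∀ v ∈ N, ¬ ((v ∈ S ∨ ∃ e ∈ W, v ∈ e) ∧ (v ∈ S ∨ ∃ e ∈ W', v ∈ e)) then (1 : ℝ) else 0 with hκdef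
  have hκ : ∀ W W', κ W W' =
      if ∀ v ∈ N, ¬ ((v ∈ S ∨ ∃ e ∈ W, v ∈ e) ∧ (v ∈ S ∨ ∃ e ∈ W', v ∈ e)) then (1 : ℝ) else 0 :=
    fun W W' => rfl
  have hw0 : ∀ e, 0 ≤ (w e : ℝ) := fun e => (w e).2.1
  have hw1 : ∀ e, (w e : ℝ) ≤ 1 := fun e => (w e).2.2
  have hp0 : ∀ W, 0 ≤ p W := fun W => Finset.sum_nonneg fun ω _ =>
    mul_nonneg (mul_nonneg (weight_nonneg hw0 hw1 ω) (ind_nonneg _ _)) (by split_ifs <;> norm_num)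
  obtain ⟨hκ01, hκsymm, hκanti⟩ := kernel_props S N κ hκ
  have hPA := pa_partner w S T N D hD C hC p hp κ hκ
  set B₀ : Finset (Set (Sym2 V)) :=
    Finset.univ.filter (fun W : Set (Sym2 V) => ∀ v ∈ N, ¬ (v ∈ S ∨ ∃ e ∈ W, v ∈ e)) with hB₀def
  have hB₀ : ∀ W ∈ B₀, ∀ W', κ W W' = 1 := fun W hW W' =>
    bottom_compat S N κ hκ W (Finset.mem_filter.1 hW).2 W'
  have hB₀pos : 0 < ∑ W ∈ B₀, p W := by
    rw [hB₀def, bottom_mass w S T N D hD C hC p hp]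
    exact lt_of_le_of_ne (Finset.sum_nonneg fun ω _ =>
      mul_nonneg (weight_nonneg hw0 hw1 ω) (ind_nonneg _ _)) (Ne.symm h0)
  have key := negCorr_symm p κ hp0 hκ01 hκsymm hκanti hPA B₀ hB₀ hB₀pos F G hF hG
  have hkc : ∀ ω ω', κ (⋃ s ∈ S, openEdgeCluster ω s) (⋃ s ∈ S, openEdgeCluster ω' s) =
      if ∀ v ∈ N, ¬ ((∃ s ∈ S, (openGraph ω).Reachable s v) ∧ ∃ s ∈ S, (openGraph ω').Reachable s v)
        then (1 : ℝ) else 0 := fun ω ω' => kernel_cluster S N C hC κ hκ ω ω'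
  have conv : ∀ Ψ : Set (Sym2 V) → Set (Sym2 V) → ℝ, ∑ W, ∑ W', p W * p W' * κ W W' * Ψ W W' =
      ∑ ω, ∑ ω', weight (fun e => (w e : ℝ)) ω * weight (fun e => (w e : ℝ)) ω' * (ind D ω * ind D ω' *
        (if ∀ v ∈ N, ¬ ((∃ s ∈ S, (openGraph ω).Reachable s v) ∧ ∃ s ∈ S, (openGraph ω').Reachable s v)
          then (1 : ℝ) else 0)) *
        Ψ (⋃ s ∈ S, openEdgeCluster ω s) (⋃ s ∈ S, openEdgeCluster ω' s) := by
    intro Ψ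
    have e1 : ∑ W, ∑ W', p W * p W' * κ W W' * Ψ W W' = ∑ W, ∑ W', p W * p W' * (κ W W' * Ψ W W') :=
      Finset.sum_congr rfl fun W _ => Finset.sum_congr rfl fun W' _ => by ring
    rw [e1, pair_sum_cluster w S D C hC p hp (fun W W' => κ W W' * Ψ W W')]
    exact Finset.sum_congr rfl fun ω _ => Finset.sum_congr rfl fun ω' _ => by
      simp only [hkc ω ω']; ring
  have conv1 : ∑ W, ∑ W', p W * p W' * κ W W' =
      ∑ ω, ∑ ω', weight (fun e => (w e : ℝ)) ω * weight (fun e => (w e : ℝ)) ω' * (ind D ω * ind D ω' *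
        (if ∀ v ∈ N, ¬ ((∃ s ∈ S, (openGraph ω).Reachable s v) ∧ ∃ s ∈ S, (openGraph ω').Reachable s v)
          then (1 : ℝ) else 0)) := by
    have := conv (fun _ _ => 1)
    simp only [mul_one] at this
    exact this
  have eF := conv (fun W _ => F W)
  have eG := conv (fun _ W' => G W')
  have eFG := conv (fun W W' => F W * G W')
  rw [← eF, ← eG, ← eFG, ← conv1]
  exact key

end Main

end TwoCopyHardCore

end Summit.CriticalPhenomena.PercolationContinuityZ3.Theorems
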